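import Summits.BirchSwinnertonDyer.BirchSwinnertonDyer.Theses.RamifiedSevenEllipticUnits
import Summits.BirchSwinnertonDyer.BirchSwinnertonDyer.Theorems.RamifiedSevenEllipticUnitsRubinPackageOfTwist
import Summits.BirchSwinnertonDyer.BirchSwinnertonDyer.Theorems.RamifiedSevenEllipticUnitsRubinFormulaZpIffValue
import Literature.NumberTheory.EllipticCurves.ComplexMultiplicationDeuringGrossencharacterUnitValues
import HarnessLib

set_option linter.dupNamespace false
set_option autoImplicit false

/-!
# K7r crux `EllipticUnitValueSevenOfGZK` (stmt-BirchSwinnertonDyer-19945), line `rubin-formula-zp` v4.4 —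
# KERNEL RECORD: the crux BY NAME from Hecke-FE, Deuring-with-GENERATORS, S_pkg⁻|𝒞₇ and S_arch|𝒞₇
# (cell `bsd-cm`, seat `bsd-cm-k7r-c2` g13, FILE 4; helper `--supports` 19945; a CONDITIONAL composition)

HONEST FRAMING. Skeleton v4.4 (`78d3f8f5baabbaa8`) registers three open stubs: S_pkg⁻
(`stub_rubinPackageReducedSevenZp`), H_Facts-two (`stub_printFactsTwoSevenLine :=
Hecke_functionalEquation_infinityType ∧ Deuring_exists_heckeCharacter_of_maximalCM_withUnitValues`) and S_arch
(`stub_archimedeanValuationSevenZp`); k7r-c4's record p520068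
(`ValueOfReducedPackage.valueSevenOfGZK_of_printFactsTwo_of_reduced_of_archimedean`) composes the crux from exactly
these. THIS FILE records the same composition with the Deuring conjunct WEAKENED to the W50 fact
`Deuring_exists_heckeCharacter_of_maximalCM_withGenerators` (clauses (i)–(vi); Silverman II 9.2, 10.4, 10.5):
clause (vii) (the values on local units are global units, Silverman II Thm. 9.1 (i) — equivalently Gross's
conductor exponent (8.2.7)) is consumed NOWHERE, because clause (P3) of the package is now supplied at `𝔭` by
the order argument for EQUIVARIANT characters (`…OddPowerUnramifiedLocal`, p526853) and away from `𝔭` by twist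
transport (`…QuadraticRamificationAwayOfTwist`, p524956), assembled in `…RubinPackageOfTwist`. What a v4.5 would
register (`stub_printFactsGeneratorsSevenLine := Hecke_functionalEquation_infinityType ∧
Deuring_exists_heckeCharacter_of_maximalCM_withGenerators`, say) is the planner's / line owner's pen — nothing is
registered here. CONDITIONAL kernel record (gate audit `proof.conditional`); credits nothing; closes nothing;
BSD is not proved for any curve; 19945 stays OPEN (S_pkg⁻ = [BKNO] PRE + readings, S_arch = research).

References: [BurungaleKobayashiNakamuraOta2026] Def. 4.7, Thm. 4.12, Thm. 7.2, §1.4 (claim; preprint; shape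
only); [SilvermanATAEC1994] II 9.2, 10.4, 10.5; [deShalit1987] II.1.1; [Miller2011LMS] Def. 1.1; cell texts
STATUS 2026-08-27 D188/D189/D196.
-/

noncomputable section

open scoped Classical

open WeierstrassCurve NumberField IsDedekindDomain
  Literature.NumberTheory.EllipticCurves
  Literature.NumberTheory.EllipticCurves.Rank1Residual
  Summit.BirchSwinnertonDyer.Rank1Residual Summit.BirchSwinnertonDyer.Rank1Residual.X12
  Summit.BirchSwinnertonDyer.Rank1Residual.X12.O11

namespace Summit.BirchSwinnertonDyer.BirchSwinnertonDyer.Theorems.RamifiedSevenEllipticUnits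

namespace RubinPackageOfTwist

/-- **KERNEL RECORD: Hecke-FE ∧ Deuring-with-GENERATORS ∧ S_pkg⁻|𝒞₇ ∧ S_arch|𝒞₇ ⟹ the crux
`EllipticUnitValueSevenOfGZK` BY NAME — the unit-values clause (vii) of v4.4's H_Facts is consumed NOWHERE.**
Hypotheses = the statements of the registered stubs S_pkg⁻ and S_arch of skeleton v4.4 VERBATIM and, in place of
`stub_printFactsTwoSevenLine = Hecke-FE ∧ Deuring-UV`, the WEAKER pair Hecke-FE ∧ Deuring-G. CONDITIONAL kernel
record; nothing registered; credits nothing; closes nothing; BSD is not proved for any curve.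
[cite: Miller2011LMS, Def. 1.1 (arXiv:1010.2431 p. 3)]
[cite: BurungaleKobayashiNakamuraOta2026, Def. 4.7, Thm. 4.12, Thm. 7.2 and §1.4 (arXiv:2608.06879 pp. 8, 27, 32, 41) (claim; preprint; shape only)]
[cite: SilvermanATAEC1994, Ch. II Thm. 9.2, Prop. 10.4, Cor. 10.4.1 (a), Thm. 10.5 (b) (Deuring's theorem with generator values)] -/
theorem valueSevenOfGZK_of_hecke_of_deuringGenerators_of_reduced_of_archimedean
    (hHecke : Hecke_functionalEquation_infinityType)
    (hD : Deuring_exists_heckeCharacter_of_maximalCM_withGenerators)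
    (hred : ∀ (W : WeierstrassCurve ℚ) [W.IsElliptic] [W.IsGloballyMinimal] [Fact (Nat.Prime 7)],
      ClassCSeven W → RamifiedCMRubinPackageReducedAtZp W 7 (-11))
    (harch : ∀ (W : WeierstrassCurve ℚ) [W.IsElliptic] [W.IsGloballyMinimal] [Fact (Nat.Prime 7)],
      ClassCSeven W → RamifiedCMArchimedeanValuationAtZp W 7 (-11)) :
    Summit.BirchSwinnertonDyer.BirchSwinnertonDyer.Theses.RamifiedSevenEllipticUnits.EllipticUnitValueSevenOfGZK :=
  RubinFormulaZpIffValue.valueSevenOfGZK_of_rubinFormulaSevenZp fun W _ _ _ hC ↦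
    rubinFormulaAtZp_seven_of_hecke_of_deuringGenerators_of_reduced_of_archimedean hHecke hD hC (hred W hC)
      (harch W hC)

/-- **The v4.4 print stub's SECOND CONJUNCT CAN BE WEAKENED**: Hecke-FE ∧ Deuring-G already give, with
S_pkg⁻|𝒞₇ and S_arch|𝒞₇, the registered fit witness `stub_rubinFormulaSevenZp`'s statement
(`∀ W ∈ 𝒞₇, RamifiedCMRubinFormulaAtZp W 7`, the line's S_open), from which the skeleton's own composition
concludes. CONDITIONAL; nothing registered. [cite: BurungaleKobayashiNakamuraOta2026, §1.4 (arXiv:2608.06879 p. 8) (shape only)] -/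
theorem rubinFormulaSevenZp_of_hecke_of_deuringGenerators_of_reduced_of_archimedean
    (hHecke : Hecke_functionalEquation_infinityType)
    (hD : Deuring_exists_heckeCharacter_of_maximalCM_withGenerators)
    (hred : ∀ (W : WeierstrassCurve ℚ) [W.IsElliptic] [W.IsGloballyMinimal] [Fact (Nat.Prime 7)],
      ClassCSeven W → RamifiedCMRubinPackageReducedAtZp W 7 (-11))
    (harch : ∀ (W : WeierstrassCurve ℚ) [W.IsElliptic] [W.IsGloballyMinimal] [Fact (Nat.Prime 7)],
      ClassCSeven W → RamifiedCMArchimedeanValuationAtZp W 7 (-11)) :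
    ∀ (W : WeierstrassCurve ℚ) [W.IsElliptic] [W.IsGloballyMinimal] [Fact (Nat.Prime 7)],
      ClassCSeven W → RamifiedCMRubinFormulaAtZp W 7 :=
  fun W _ _ _ hC ↦
    rubinFormulaAtZp_seven_of_hecke_of_deuringGenerators_of_reduced_of_archimedean hHecke hD hC (hred W hC)
      (harch W hC)

/-- **Drop-in under the REGISTERED v4.4 stub statements** (`Hecke-FE ∧ Deuring-UV`, S_pkg⁻, S_arch): the crux
through the generators fact only (`…withGenerators_of_withUnitValues` forgets clause (vii)) — same hypotheses as
k7r-c4's `ValueOfReducedPackage.valueSevenOfGZK_of_printFactsTwo_of_reduced_of_archimedean`, but a closure in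
which clause (vii) is projected away at once and never used. CONDITIONAL; nothing registered.
[cite: Miller2011LMS, Def. 1.1 (arXiv:1010.2431 p. 3)] -/
theorem valueSevenOfGZK_of_printFactsTwo_via_generators
    (hF : Hecke_functionalEquation_infinityType ∧ Deuring_exists_heckeCharacter_of_maximalCM_withUnitValues)
    (hred : ∀ (W : WeierstrassCurve ℚ) [W.IsElliptic] [W.IsGloballyMinimal] [Fact (Nat.Prime 7)],
      ClassCSeven W → RamifiedCMRubinPackageReducedAtZp W 7 (-11))
    (harch : ∀ (W : WeierstrassCurve ℚ) [W.IsElliptic] [W.IsGloballyMinimal] [Fact (Nat.Prime 7)],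
      ClassCSeven W → RamifiedCMArchimedeanValuationAtZp W 7 (-11)) :
    Summit.BirchSwinnertonDyer.BirchSwinnertonDyer.Theses.RamifiedSevenEllipticUnits.EllipticUnitValueSevenOfGZK ∧
      ∀ (W : WeierstrassCurve ℚ) [W.IsElliptic] [W.IsGloballyMinimal] [Fact (Nat.Prime 7)],
        ClassCSeven W → RamifiedCMRubinFormulaAtZp W 7 :=
  ⟨valueSevenOfGZK_of_hecke_of_deuringGenerators_of_reduced_of_archimedean hF.1
      (Deuring_exists_heckeCharacter_of_maximalCM_withGenerators_of_withUnitValues hF.2) hred harch,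
    rubinFormulaSevenZp_of_hecke_of_deuringGenerators_of_reduced_of_archimedean hF.1
      (Deuring_exists_heckeCharacter_of_maximalCM_withGenerators_of_withUnitValues hF.2) hred harch⟩

end RubinPackageOfTwist

end Summit.BirchSwinnertonDyer.BirchSwinnertonDyer.Theorems.RamifiedSevenEllipticUnits

end
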